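import Summits.NavierStokesRegularity.NavierStokesRegularity.Theorems.LerayQuarterDissipationFiniteDissipationLiouvilleSliceContinuity
import HarnessLib

/-!
# Route `LerayQuarterDissipation`, crux `FiniteDissipationLiouville` (stmt-NavierStokesRegularity-22144),
  line `birth` — the near-one DSS leaf of the stratum, unconditionally (Chae–Wolf 2017 on `𝒟`)

`--supports stmt-NavierStokesRegularity-22144` (helper). With the envelope bridge
`exists_hasTypeIDecay_of_dss` (file `…SliceContinuity.lean`) the envelope hypothesis of the
near-one leaf `exists_dss_threshold_of_envelope` (file `…DssCorners.lean`) is discharged on the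
finite-dissipation stratum: **every `c`-DSS member `w` of the stratum carries a threshold
`c₁(w) > 1` — depending on `w` only through an envelope constant — such that `w ≡ 0` whenever its
factor satisfies `c < c₁(w)`** (`exists_dss_threshold`). This is Chae–Wolf 2017 Thm 1.1 + Thm 1.3
(both PROVED in the tree) run on the stratum with no extra hypothesis; what it does NOT give is a
threshold uniform in `w`, i.e. the large-`λ` case — the catalogued wall `TypeIDSSLiouville`.
Nothing here bears on Navier–Stokes regularity; no summit is proved.
-/

noncomputable section

open Set MeasureTheory Filter Topology Function Metric
open Literature.Analysis Literature.Analysis.FluidPDE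
open scoped ENNReal NNReal

namespace Summit.NavierStokesRegularity.NavierStokesRegularity.Theorems.FiniteDissipationLiouville.Birth

-- the problem-side namespace duplicates `NavierStokesRegularity` by design (summit = problem)
set_option linter.dupNamespace false

/-- **The near-one DSS leaf of the stratum, unconditionally.** For every `c`-DSS member `w` of the
finite-dissipation stratum (`c > 1`) there is `c₁ > 1` such that `c < c₁` forces `w ≡ 0` on
`t < 0` (envelope bridge `exists_hasTypeIDecay_of_dss`, then Chae–Wolf 2017 Thm 1.3 through
`exists_dss_threshold_of_envelope`; the envelope constant is first raised to `max C₀ 1 > 0`). -/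
theorem exists_dss_threshold {C K c : ℝ}
    {w : ℝ → EuclideanSpace ℝ (Fin 3) → EuclideanSpace ℝ (Fin 3)} (hw : IsTypeIAncientMild C w)
    (hD : ∀ s : ℝ, s < 0 → ∫⁻ x, ‖fderiv ℝ (w s) x‖ₑ ^ 2 ≤ ENNReal.ofReal (K / Real.sqrt (-s)))
    (hc : 1 < c) (hdss : IsDiscretelySelfSimilar c w) :
    ∃ c₁ : ℝ, 1 < c₁ ∧ (c < c₁ → ∀ t < 0, ∀ x, w t x = 0) := by
  obtain ⟨C₀, henv⟩ := exists_hasTypeIDecay_of_dss hw hD hc hdss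
  -- raise the envelope constant to a positive one
  have henv' : HasTypeIDecay (max C₀ 1) w := fun t ht x => (henv t ht x).trans
    (div_le_div_of_nonneg_right (le_max_left _ _)
      (add_pos_of_nonneg_of_pos (norm_nonneg _) (Real.sqrt_pos.2 (by linarith))).le)
  obtain ⟨c₁, hc₁, H⟩ := exists_dss_threshold_of_envelope (lt_max_of_lt_right one_pos : 0 < max C₀ 1)
  exact ⟨c₁, hc₁, fun hcc => H C c w hc hcc hw henv' hdss⟩

/-- The same in the regularity form of the crux: such a member with `c < c₁(w)` is bounded at the
apex. -/
theorem exists_dss_threshold_notSingular {C K c : ℝ}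
    {w : ℝ → EuclideanSpace ℝ (Fin 3) → EuclideanSpace ℝ (Fin 3)} (hw : IsTypeIAncientMild C w)
    (hD : ∀ s : ℝ, s < 0 → ∫⁻ x, ‖fderiv ℝ (w s) x‖ₑ ^ 2 ≤ ENNReal.ofReal (K / Real.sqrt (-s)))
    (hc : 1 < c) (hdss : IsDiscretelySelfSimilar c w) :
    ∃ c₁ : ℝ, 1 < c₁ ∧ (c < c₁ →
      ¬ (∀ r > 0, ∀ M : ℝ, ∃ t ∈ Set.Ioo (-(r ^ 2)) (0 : ℝ),
          ∃ x ∈ Metric.ball (0 : EuclideanSpace ℝ (Fin 3)) r, M < ‖w t x‖)) := by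
  obtain ⟨c₁, hc₁, H⟩ := exists_dss_threshold hw hD hc hdss
  exact ⟨c₁, hc₁, fun hcc => not_singularAtApex_of_eq_zero (H hcc)⟩

end Summit.NavierStokesRegularity.NavierStokesRegularity.Theorems.FiniteDissipationLiouville.Birth

end
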